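import Literature.NumberTheory.NumberFields.SelmerGroupPID
import HarnessLib

/-!
# Residues modulo `128` at a dyadic prime of degree one

Local data at a prime `𝔭` of a number field `K` above `2` with `e = f = 1` (`K_𝔭 = ℚ₂`), possibly
NON-principal, packaged for the local computations of a `2`-descent: a `DyadicPlace` consists of
the place `v`, a ring homomorphism `red : 𝓞 K → ℤ/128` with `z ∈ 𝔭 ↔ red z even` (in practice the
quotient map `𝓞 K → 𝓞 K/𝔭⁷ ≅ ℤ/2⁷`), `ord_𝔭(2) = 1`, and an element `μ ∉ 𝔭` divisible by all the
other primes above `2`, through the hypothesis `decomp`: every `Z ≠ 0` becomes `2^a Z₀` with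
`Z₀ ∉ 𝔭` after multiplication by a power of `Λ = μ³²` (`red Λ = 1` as `(ℤ/128)ˣ` has exponent `32`).
For `z ∈ Kˣ` we then define the relation `HasRes z r` ("the `𝔭`-adic unit part of `z` reduces to
`r ∈ (ℤ/128)ˣ`": `Λ^N z W₀ 2^b = 2^a Z₀`, `red Z₀ = r · red W₀`) and prove existence, uniqueness,
multiplicativity, the valuation `ord_𝔭(z) = a - b`, and the values on `𝔭`-units of `𝓞 K`, on `2` and
on squares. (This replaces "divide by the prime element `2`" of the inert case.) Theorems only, plus
the structure `DyadicPlace` and the definition `HasRes`. [cite: SilvermanAEC2009, Prop. X.1.4]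

## References

* J. H. Silverman, *The Arithmetic of Elliptic Curves*, 2nd ed., GTM 106 (2009), §X.1 (local
  computations of the `2`-descent). [SilvermanAEC2009]
-/

noncomputable section

open scoped NumberField

open NumberField IsDedekindDomain IsDedekindDomain.HeightOneSpectrum Ideal

namespace Literature.NumberTheory.NumberFields

variable {K : Type*} [Field K] [NumberField K]

/-- **Local data at a dyadic prime of degree one.** [cite: SilvermanAEC2009, Prop. X.1.4] -/
structure DyadicPlace (K : Type*) [Field K] [NumberField K] where
  /-- the place -/
  v : HeightOneSpectrum (𝓞 K)
  /-- reduction modulo `𝔭⁷`, valued in `ℤ/128` -/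
  red : 𝓞 K →+* ZMod 128
  /-- `z ∈ 𝔭 ↔ red z` is even -/
  mem_iff : ∀ z : 𝓞 K, z ∈ v.asIdeal ↔ 2 ∣ (red z).val
  /-- `ord_𝔭(2) = 1` -/
  log_two : WithZero.log (v.valuation K (2 : K)) = -1
  /-- an element prime to `𝔭` absorbing the other primes above `2` -/
  μ : 𝓞 K
  μ_not_mem : μ ∉ v.asIdeal
  /-- extraction of `𝔭`-unit parts after multiplication by powers of `μ³²` -/
  decomp : ∀ Z : 𝓞 K, Z ≠ 0 → ∃ (N a : ℕ) (Z₀ : 𝓞 K), (μ ^ 32) ^ N * Z = 2 ^ a * Z₀ ∧ Z₀ ∉ v.asIdeal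

namespace DyadicPlace

variable (P : DyadicPlace K)

/-- `Λ = μ³²`. [folklore] -/
def Λ : 𝓞 K := P.μ ^ 32

/-- `decomp` in terms of `Λ`. [folklore] -/
theorem decomp' (Z : 𝓞 K) (hZ : Z ≠ 0) :
    ∃ (N a : ℕ) (Z₀ : 𝓞 K), P.Λ ^ N * Z = 2 ^ a * Z₀ ∧ Z₀ ∉ P.v.asIdeal := P.decomp Z hZ

/-! ### Odd residues -/

/-- Odd residues of `ℤ/128` have `r³² = 1`. [folklore] -/
theorem pow_32_eq_one : ∀ r : ZMod 128, ¬ 2 ∣ r.val → r ^ 32 = 1 := by decide +kernel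

/-- The `2`-adic valuation of a residue modulo `128` (`7` for `0`). [folklore] -/
def val2 (x : ZMod 128) : ℕ := if x = 0 then 7 else Nat.findGreatest (fun k => 2 ^ k ∣ x.val) 6

/-- `val2 (2^d s) = d` for `s` odd and `d ≤ 6`. [folklore] -/
theorem val2_two_pow_mul : ∀ d : Fin 7, ∀ s : ZMod 128, ¬ 2 ∣ s.val →
    val2 ((2 : ZMod 128) ^ (d : ℕ) * s) = d := by decide +kernel

/-- `2^m · (odd) = 2^n · (odd)` in `ℤ/128` with `m ≤ 6` forces `m = n`. [folklore] -/
theorem pow_two_mul_odd_inj {m n : ℕ} {r s : ZMod 128} (hr : ¬ 2 ∣ r.val) (hs : ¬ 2 ∣ s.val)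
    (hm : m ≤ 6) (h : (2 : ZMod 128) ^ m * r = 2 ^ n * s) : m = n := by
  have h1 := val2_two_pow_mul ⟨m, by omega⟩ r hr
  simp only at h1
  rcases le_or_gt n 6 with hn | hn
  · have h2 := val2_two_pow_mul ⟨n, by omega⟩ s hs
    simp only at h2
    rw [h] at h1; omega
  · exfalso
    obtain ⟨d, rfl⟩ := Nat.exists_eq_add_of_lt hn
    have h0 : (2 : ZMod 128) ^ (6 + d + 1) * s = 0 := by
      rw [show 6 + d + 1 = 7 + d by omega, pow_add, show (2 : ZMod 128) ^ 7 = 0 by decide]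
      ring
    rw [h0] at h
    have key : ∀ d : Fin 7, ∀ r : ZMod 128, ¬ 2 ∣ r.val → (2 : ZMod 128) ^ (d : ℕ) * r ≠ 0 := by
      decide +kernel
    exact key ⟨m, by omega⟩ r hr h

/-- `z ∉ 𝔭 ↔ red z` is odd. [folklore] -/
theorem not_mem_iff (z : 𝓞 K) : z ∉ P.v.asIdeal ↔ ¬ 2 ∣ (P.red z).val := by
  rw [P.mem_iff]

/-- `red Λ = 1`. [folklore] -/
theorem red_Λ : P.red P.Λ = 1 := by
  rw [Λ, map_pow]
  exact pow_32_eq_one _ ((P.not_mem_iff _).mp P.μ_not_mem)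

/-- `Λ ∉ 𝔭`, and powers. [folklore] -/
theorem Λ_pow_not_mem (N : ℕ) : P.Λ ^ N ∉ P.v.asIdeal := by
  rw [P.not_mem_iff, map_pow, P.red_Λ, one_pow]
  decide

/-- `2 ∈ 𝔭`. [folklore] -/
theorem two_mem : (2 : 𝓞 K) ∈ P.v.asIdeal := by
  rw [P.mem_iff, map_ofNat]; decide

/-- Products of elements outside `𝔭` are outside `𝔭`. [folklore] -/
theorem mul_not_mem {a b : 𝓞 K} (ha : a ∉ P.v.asIdeal) (hb : b ∉ P.v.asIdeal) :
    a * b ∉ P.v.asIdeal := fun h => (P.v.isPrime.mem_or_mem h).elim ha hb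

/-- **Comparing `2^m A = 2^n B` with `A, B ∉ 𝔭`**: `m = n` and `A = B`. [folklore] -/
theorem pow_mul_inj {m n : ℕ} {A B : 𝓞 K} (hA : A ∉ P.v.asIdeal) (hB : B ∉ P.v.asIdeal)
    (h : (2 : 𝓞 K) ^ m * A = 2 ^ n * B) : m = n ∧ A = B := by
  have key : ∀ {m n : ℕ} {A B : 𝓞 K}, A ∉ P.v.asIdeal → (2 : 𝓞 K) ^ m * A = 2 ^ n * B → ¬ m < n := by
    intro m n A B hA h hlt
    obtain ⟨d, rfl⟩ := Nat.exists_eq_add_of_lt hlt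
    have e : A = 2 ^ (d + 1) * B := by
      have h' : (2 : 𝓞 K) ^ m * A = 2 ^ m * (2 ^ (d + 1) * B) := by rw [h]; ring
      exact mul_left_cancel₀ (pow_ne_zero m two_ne_zero) h'
    exact hA (e ▸ P.v.asIdeal.mul_mem_right B
      (P.v.asIdeal.pow_mem_of_mem P.two_mem (d + 1) (Nat.succ_pos d)))
  have hmn : m = n := by
    rcases Nat.lt_trichotomy m n with hlt | heq | hgt
    · exact absurd hlt (key hA h)
    · exact heq
    · exact absurd hgt (key hB h.symm)
  subst hmn
  exact ⟨rfl, mul_left_cancel₀ (pow_ne_zero m two_ne_zero) h⟩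

/-! ### Valuations -/

/-- `log v` of an element of `𝓞 K` outside `𝔭` is `0`; of `2^a` is `-a`. [folklore] -/
theorem log_eq_zero {Z : 𝓞 K} (hZ : Z ∉ P.v.asIdeal) :
    WithZero.log (P.v.valuation K (Z : K)) = 0 :=
  log_valuation_eq_zero_of_not_mem _ hZ

/-- `log v (2^a) = -a`. [folklore] -/
theorem log_two_pow (a : ℕ) : WithZero.log (P.v.valuation K ((2 : K) ^ a)) = -(a : ℤ) := by
  rw [map_pow, WithZero.log_pow, P.log_two]; simp

/-! ### The residue relation -/

/-- **`HasRes z r`**: the `𝔭`-adic unit part of `z ∈ Kˣ` reduces to `r` modulo `128`: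
`Λ^N z W₀ 2^b = 2^a Z₀` with `Z₀, W₀ ∉ 𝔭` and `red Z₀ = r · red W₀`. [folklore] -/
def HasRes (z : K) (r : ZMod 128) : Prop :=
  ∃ (N a b : ℕ) (Z₀ W₀ : 𝓞 K), Z₀ ∉ P.v.asIdeal ∧ W₀ ∉ P.v.asIdeal ∧
    ((P.Λ : 𝓞 K) : K) ^ N * z * W₀ * 2 ^ b = 2 ^ a * Z₀ ∧ P.red Z₀ = r * P.red W₀

/-- Residues are odd. [folklore] -/
theorem HasRes.odd {z : K} {r : ZMod 128} (h : P.HasRes z r) : ¬ 2 ∣ r.val := by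
  obtain ⟨N, a, b, Z₀, W₀, hZ, hW, -, hr⟩ := h
  rw [P.not_mem_iff] at hZ hW
  intro h2
  apply hZ
  rw [hr]
  have : ∀ r s : ZMod 128, 2 ∣ r.val → 2 ∣ (r * s).val := by decide +kernel
  exact this r _ h2

/-- A `𝔭`-unit of `𝓞 K` has residue `red Z`. [folklore] -/
theorem HasRes.of_not_mem {Z : 𝓞 K} (hZ : Z ∉ P.v.asIdeal) : P.HasRes (Z : K) (P.red Z) :=
  ⟨0, 0, 0, Z, 1, hZ, by rw [P.not_mem_iff, map_one]; decide, by simp, by simp⟩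

/-- `2^a Z` (`Z ∉ 𝔭`) has residue `red Z`. [folklore] -/
theorem HasRes.two_pow_mul {Z : 𝓞 K} (hZ : Z ∉ P.v.asIdeal) (a : ℕ) :
    P.HasRes ((2 : K) ^ a * Z) (P.red Z) :=
  ⟨0, a, 0, Z, 1, hZ, by rw [P.not_mem_iff, map_one]; decide, by simp, by simp⟩

/-- **Multiplicativity.** [folklore] -/
theorem HasRes.mul {z z' : K} {r r' : ZMod 128} (h : P.HasRes z r) (h' : P.HasRes z' r') :
    P.HasRes (z * z') (r * r') := by
  obtain ⟨N, a, b, Z₀, W₀, hZ, hW, he, hr⟩ := h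
  obtain ⟨N', a', b', Z₀', W₀', hZ', hW', he', hr'⟩ := h'
  refine ⟨N + N', a + a', b + b', Z₀ * Z₀', W₀ * W₀', P.mul_not_mem hZ hZ', P.mul_not_mem hW hW',
    ?_, ?_⟩
  · push_cast
    calc ((P.Λ : 𝓞 K) : K) ^ (N + N') * (z * z') * (W₀ * W₀') * 2 ^ (b + b')
        = (((P.Λ : 𝓞 K) : K) ^ N * z * W₀ * 2 ^ b) * (((P.Λ : 𝓞 K) : K) ^ N' * z' * W₀' * 2 ^ b') := by
          ring
      _ = (2 ^ a * Z₀) * (2 ^ a' * Z₀') := by rw [he, he']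
      _ = 2 ^ (a + a') * (Z₀ * Z₀' : 𝓞 K) := by push_cast; ring
  · rw [map_mul, map_mul, hr, hr']; ring

/-- **Existence**: every `z ≠ 0` has a residue. [folklore] -/
theorem HasRes.exists {z : K} (hz : z ≠ 0) : ∃ r, P.HasRes z r := by
  obtain ⟨X, Y, hY, hXY⟩ := IsFractionRing.div_surjective (A := 𝓞 K) z
  have hY0 : Y ≠ 0 := nonZeroDivisors.ne_zero hY
  have hX0 : X ≠ 0 := by
    rintro rfl
    rw [map_zero, zero_div] at hXY
    exact hz hXY.symm
  obtain ⟨N, a, X₀, hX, hX₀⟩ := P.decomp' X hX0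
  obtain ⟨M, b, Y₀, hYd, hY₀⟩ := P.decomp' Y hY0
  -- `Λ^(N+M) z Y₀ 2^b = 2^a (X₀ Λ^M)` : from `Λ^N X = 2^a X₀`, `Λ^M Y = 2^b Y₀`, `z = X / Y`
  have hY0' : ((Y : 𝓞 K) : K) ≠ 0 := by exact_mod_cast hY0
  have hred : P.red (P.Λ ^ M * X₀) = (P.red X₀ * P.red Y₀ ^ 31) * P.red Y₀ := by
    rw [map_mul, map_pow, P.red_Λ, one_pow, one_mul, mul_assoc, ← pow_succ]
    rw [pow_32_eq_one _ ((P.not_mem_iff _).mp hY₀), mul_one]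
  refine ⟨P.red X₀ * P.red Y₀ ^ 31, N, a, b, P.Λ ^ M * X₀, Y₀,
    P.mul_not_mem (P.Λ_pow_not_mem M) hX₀, hY₀, ?_, hred⟩
  have e1 := congrArg (algebraMap (𝓞 K) K) hX
  have e2 := congrArg (algebraMap (𝓞 K) K) hYd
  simp only [map_mul, map_pow, map_ofNat] at e1 e2
  simp only [RingOfIntegers.coe_eq_algebraMap, map_mul, map_pow]
  rw [← hXY]
  have hY0'' : algebraMap (𝓞 K) K Y ≠ 0 := by rwa [RingOfIntegers.coe_eq_algebraMap] at hY0'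
  field_simp
  linear_combination (algebraMap (𝓞 K) K Y₀) * 2 ^ b * e1 -
    2 ^ a * (algebraMap (𝓞 K) K X₀) * e2

/-- **The valuation from a representation**: `Λ^N z W₀ 2^b = 2^a Z₀` gives `log v z = b - a`
(`ord_𝔭(z) = a - b`). [folklore] -/
theorem log_of_rep {z : K} (hz : z ≠ 0) {N a b : ℕ} {Z₀ W₀ : 𝓞 K} (hZ : Z₀ ∉ P.v.asIdeal)
    (hW : W₀ ∉ P.v.asIdeal) (he : ((P.Λ : 𝓞 K) : K) ^ N * z * W₀ * 2 ^ b = 2 ^ a * Z₀) :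
    WithZero.log (P.v.valuation K z) = (b : ℤ) - a := by
  have hne : ∀ {w : K}, w ≠ 0 → P.v.valuation K w ≠ 0 := fun hw => (P.v.valuation K).ne_zero_iff.mpr hw
  have hZ0 : ((Z₀ : 𝓞 K) : K) ≠ 0 := fun h => hZ (by
    have : Z₀ = 0 := by exact_mod_cast h
    rw [this]; exact P.v.asIdeal.zero_mem)
  have hW0 : ((W₀ : 𝓞 K) : K) ≠ 0 := fun h => hW (by
    have : W₀ = 0 := by exact_mod_cast h
    rw [this]; exact P.v.asIdeal.zero_mem)
  have hL0 : ((P.Λ : 𝓞 K) : K) ≠ 0 := fun h => P.Λ_pow_not_mem 1 (by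
    have : P.Λ = 0 := by exact_mod_cast h
    rw [pow_one, this]; exact P.v.asIdeal.zero_mem)
  have h2b : P.v.valuation K ((2 : K) ^ b) ≠ 0 := hne (pow_ne_zero _ two_ne_zero)
  have h2a : P.v.valuation K ((2 : K) ^ a) ≠ 0 := hne (pow_ne_zero _ two_ne_zero)
  have hLN : P.v.valuation K (((P.Λ : 𝓞 K) : K) ^ N) ≠ 0 := hne (pow_ne_zero _ hL0)
  have lL : WithZero.log (P.v.valuation K (((P.Λ : 𝓞 K) : K) ^ N)) = 0 := by
    have := P.log_eq_zero (P.Λ_pow_not_mem N)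
    push_cast at this
    exact this
  have key := congrArg (fun w => WithZero.log (P.v.valuation K w)) he
  simp only [map_mul] at key
  rw [WithZero.log_mul (mul_ne_zero (mul_ne_zero hLN (hne hz)) (hne hW0)) h2b,
    WithZero.log_mul (mul_ne_zero hLN (hne hz)) (hne hW0), WithZero.log_mul hLN (hne hz),
    WithZero.log_mul h2a (hne hZ0), lL, P.log_eq_zero hZ, P.log_eq_zero hW, P.log_two_pow,
    P.log_two_pow] at key
  linarith

/-- **The valuation of `z` from `HasRes`**: some representation computes it. [folklore] -/
theorem HasRes.exists_rep {z : K} {r : ZMod 128} (h : P.HasRes z r) :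
    ∃ (N a b : ℕ) (Z₀ W₀ : 𝓞 K), Z₀ ∉ P.v.asIdeal ∧ W₀ ∉ P.v.asIdeal ∧
      ((P.Λ : 𝓞 K) : K) ^ N * z * W₀ * 2 ^ b = 2 ^ a * Z₀ ∧ P.red Z₀ = r * P.red W₀ := h

/-- **Uniqueness of the residue.** [folklore] -/
theorem HasRes.unique {z : K} {r r' : ZMod 128} (h : P.HasRes z r)
    (h' : P.HasRes z r') : r = r' := by
  obtain ⟨N, a, b, Z₀, W₀, hZ, hW, he, hr⟩ := h
  obtain ⟨N', a', b', Z₀', W₀', hZ', hW', he', hr'⟩ := h'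
  -- cross-multiplied: `2^(a+b') (Z₀ Λ^N' W₀') = 2^(a'+b) (Z₀' Λ^N W₀)`
  have hL0 : ((P.Λ : 𝓞 K) : K) ≠ 0 := fun h => P.Λ_pow_not_mem 1 (by
    have : P.Λ = 0 := by exact_mod_cast h
    rw [pow_one, this]; exact P.v.asIdeal.zero_mem)
  have cross : (2 : 𝓞 K) ^ (a + b') * (Z₀ * P.Λ ^ N' * W₀') = 2 ^ (a' + b) * (Z₀' * P.Λ ^ N * W₀) := by
    rw [RingOfIntegers.ext_iff]
    simp only [map_mul, map_pow, RingOfIntegers.coe_eq_algebraMap] at he he' ⊢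
    have hc2 : algebraMap (𝓞 K) K 2 = 2 := map_ofNat _ 2
    rw [hc2]
    have e1 := congrArg (· * ((algebraMap (𝓞 K) K P.Λ) ^ N' * algebraMap (𝓞 K) K W₀' * 2 ^ b')) he
    have e2 := congrArg (· * ((algebraMap (𝓞 K) K P.Λ) ^ N * algebraMap (𝓞 K) K W₀ * 2 ^ b)) he'
    linear_combination e2 - e1
  obtain ⟨-, heq⟩ := P.pow_mul_inj (P.mul_not_mem (P.mul_not_mem hZ (P.Λ_pow_not_mem N')) hW')
    (P.mul_not_mem (P.mul_not_mem hZ' (P.Λ_pow_not_mem N)) hW) cross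
  have hred := congrArg P.red heq
  simp only [map_mul, map_pow, P.red_Λ, one_pow, mul_one, hr, hr'] at hred
  -- cancel the odd residues `red W₀`, `red W₀'`
  have hWo := (P.not_mem_iff _).mp hW
  have hWo' := (P.not_mem_iff _).mp hW'
  have key : r * (P.red W₀ * P.red W₀') = r' * (P.red W₀ * P.red W₀') := by
    linear_combination hred
  have hunit : ∀ u : ZMod 128, ¬ 2 ∣ u.val → u * u ^ 31 = 1 := fun u hu => by
    rw [← pow_succ']; exact pow_32_eq_one u hu
  calc r = r * (P.red W₀ * P.red W₀') * (P.red W₀ ^ 31 * P.red W₀' ^ 31) := by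
          rw [mul_assoc, show P.red W₀ * P.red W₀' * (P.red W₀ ^ 31 * P.red W₀' ^ 31) =
            (P.red W₀ * P.red W₀ ^ 31) * (P.red W₀' * P.red W₀' ^ 31) by ring, hunit _ hWo,
            hunit _ hWo', mul_one, mul_one]
    _ = r' * (P.red W₀ * P.red W₀') * (P.red W₀ ^ 31 * P.red W₀' ^ 31) := by rw [key]
    _ = r' := by
          rw [mul_assoc, show P.red W₀ * P.red W₀' * (P.red W₀ ^ 31 * P.red W₀' ^ 31) =
            (P.red W₀ * P.red W₀ ^ 31) * (P.red W₀' * P.red W₀' ^ 31) by ring, hunit _ hWo,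
            hunit _ hWo', mul_one, mul_one]

/-- **Inverses**: `HasRes z r → HasRes z⁻¹ r³¹`. [folklore] -/
theorem HasRes.inv {z : K} (hz : z ≠ 0) {r : ZMod 128} (h : P.HasRes z r) :
    P.HasRes z⁻¹ (r ^ 31) := by
  obtain ⟨N, a, b, Z₀, W₀, hZ, hW, he, hr⟩ := h
  refine ⟨0, b, a, P.Λ ^ N * W₀, Z₀, P.mul_not_mem (P.Λ_pow_not_mem N) hW, hZ, ?_, ?_⟩
  · rw [pow_zero, one_mul]
    calc z⁻¹ * ((Z₀ : 𝓞 K) : K) * 2 ^ a = z⁻¹ * (2 ^ a * ((Z₀ : 𝓞 K) : K)) := by ring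
      _ = z⁻¹ * (((P.Λ : 𝓞 K) : K) ^ N * z * W₀ * 2 ^ b) := by rw [he]
      _ = 2 ^ b * ((P.Λ ^ N * W₀ : 𝓞 K) : K) := by
          push_cast; field_simp
  · rw [map_mul, map_pow, P.red_Λ, one_pow, one_mul, hr]
    have := pow_32_eq_one r ?_
    · linear_combination (-P.red W₀) * this
    · -- `r` is odd since `red Z₀ = r · red W₀` is odd
      intro h2
      apply (P.not_mem_iff _).mp hZ
      rw [hr]
      have key : ∀ r s : ZMod 128, 2 ∣ r.val → 2 ∣ (r * s).val := by decide +kernel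
      exact key r _ h2

/-- `HasRes (-1) (-1)`. [folklore] -/
theorem HasRes.neg_one : P.HasRes (-1 : K) (-1) := by
  have h : (-1 : 𝓞 K) ∉ P.v.asIdeal := by
    rw [P.not_mem_iff, map_neg, map_one]; decide
  have := HasRes.of_not_mem P h
  rw [map_neg, map_one] at this
  simpa using this

/-- `HasRes 2 1`. [folklore] -/
theorem HasRes.two : P.HasRes (2 : K) 1 := by
  have h : (1 : 𝓞 K) ∉ P.v.asIdeal := by rw [P.not_mem_iff, map_one]; decide
  have := HasRes.two_pow_mul P h 1
  rw [map_one] at this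
  simpa using this

/-- `HasRes n n` for odd numerals `n` (as algebraic integers outside `𝔭`). [folklore] -/
theorem HasRes.natCast {n : ℕ} (hn : ¬ 2 ∣ ((n : ZMod 128)).val) : P.HasRes (n : K) n := by
  have h : (n : 𝓞 K) ∉ P.v.asIdeal := by rw [P.not_mem_iff, map_natCast]; exact hn
  have := HasRes.of_not_mem P h
  rw [map_natCast] at this
  simpa using this

/-- **Squares have square residues**, in particular `≡ 1 (mod 8)`. [folklore] -/
theorem HasRes.of_sq {c : K} (hc : c ≠ 0) {r : ZMod 128} (h : P.HasRes (c ^ 2) r) :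
    ∃ s : ZMod 128, ¬ 2 ∣ s.val ∧ r = s ^ 2 := by
  obtain ⟨s, hs⟩ := HasRes.exists P hc
  refine ⟨s, HasRes.odd P hs, ?_⟩
  have := HasRes.mul P hs hs
  rw [← sq, ← sq] at this
  exact HasRes.unique P h this

end DyadicPlace

end Literature.NumberTheory.NumberFields

end
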